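import Mathlib
import Summits.KontsevichZagierPeriods.Zeta5Search.FamilyCellDDigits
import HarnessLib

/-!
# ζ(5) search — the CLASS ATLAS of the record ray at the primes `8.5n < p < 9n` (census g11 cell C) and its minimal classes

Cell `pub-zeta5` (HONEST FRAMING: systematic search; no irrationality claim unless certified), P1 prover seat generation 6.
Census g11's cell atlas of `b(n) = n·(41;17,…,11)` (`STRUCTURE §15.4`) has, besides A (weight 1.000) and B, D (0.500 each), the cell
**C = θ ∈ (17/2, 9)** (weight 0.500 nats/step; `v_p(Cas₇) = −12` at 13/13 instances, proved `−13`); gen-2 g9's all-`n` atlas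
(REPORT-gen2-g9 §10) classifies it as an LB♯♯ cell with `m = −8` and FOUR-point deep types `(1,−4,−6,1)`, `(1,−6,−4,1)`, `(1,−5,−5,1)`,
so the digit layer of the cell-D proof (`digits_of_level` with `L = 3`) applies verbatim.  This file is the arithmetic: for
`17n < 2p < 18n` the classes have four or five points (`classSet_bRecC`); the minimal classes are `CMinT1 = {15n ≤ x+p, x+2p ≤ 24n,
41n < x+4p}`, `CMinS = {16n ≤ x+p, x+2p ≤ 25n, 2x+3p ≠ 41n}` (not self-conjugate) and `CMinT2 = {17n ≤ x+p, x+2p ≤ 26n}` (the conjugates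
`41n − (x+3p)` of `CMinT1`), with their net exponents for `b(n)` and `b(n)+e₇`; EVERY OTHER class has `E_x ≥ −7` (`classExpC_ge_of_notMin`;
the self-conjugate four-point classes `2x + 3p = 41n` carry the odd centre).  Exact arithmetic on the ray; cross-checked at the 7 primes of
the cell with `n ≤ 12` (`code/p1/g6/cellE_check.py`).  Nothing about irrationality.
-/

open Finset

namespace Summit.KontsevichZagierPeriods.Zeta5Search.CellC

open Summit.KontsevichZagierPeriods.Zeta5Search.ClusterValuation
open Summit.KontsevichZagierPeriods.Zeta5Search.CasoratianValuation (shift)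
open Summit.KontsevichZagierPeriods.Zeta5Search.BigPrime (block shift_zero)
open Summit.KontsevichZagierPeriods.Zeta5Search.CellA
open Summit.KontsevichZagierPeriods.Zeta5Search.CellD (dep7_well netExp_centre sum_five')

/-! ### §1 The residue classes for `17n < 2p < 18n` -/

section Classes

variable {n p : ℕ} (hp : 17 * n < 2 * p) (hp' : 2 * p < 18 * n)

include hp hp' in
/-- **The class of `x < p`**: `{x, x+p, …, x+4p}` if `x + 4p ≤ 41n`, else `{x, x+p, x+2p, x+3p}`. -/
theorem classSet_bRecC {x : ℕ} (hx : x < p) :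
    classSet (bRec n) p x = if x + 4 * p ≤ 41 * n then {x, x + p, x + 2 * p, x + 3 * p, x + 4 * p}
      else {x, x + p, x + 2 * p, x + 3 * p} := by
  ext s
  rw [mem_classSet_iff, bRec_zero_toNat]
  have key : (s ≤ 41 * n ∧ (p : ℤ) ∣ (s : ℤ) - x) ↔
      (s = x ∨ s = x + p ∨ s = x + 2 * p ∨ s = x + 3 * p ∨ (s = x + 4 * p ∧ x + 4 * p ≤ 41 * n)) := by
    constructor
    · rintro ⟨hs, k, hk⟩
      have hk0 : 0 ≤ k := by
        by_contra hneg
        push Not at hneg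
        have : (p : ℤ) * k ≤ (p : ℤ) * (-1) := mul_le_mul_of_nonneg_left (by omega) (by omega)
        omega
      have hk5 : k < 5 := by
        by_contra hge
        push Not at hge
        have : (p : ℤ) * 5 ≤ (p : ℤ) * k := mul_le_mul_of_nonneg_left hge (by omega)
        omega
      interval_cases k <;> omega
    · rintro (rfl | rfl | rfl | rfl | ⟨rfl, h⟩)
      · exact ⟨by omega, 0, by ring⟩
      · exact ⟨by omega, 1, by push_cast; ring⟩
      · exact ⟨by omega, 2, by push_cast; ring⟩
      · exact ⟨by omega, 3, by push_cast; ring⟩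
      · exact ⟨h, 4, by push_cast; ring⟩
  rw [key]
  split_ifs with h5
  · simp only [mem_insert, mem_singleton]; tauto
  · simp only [mem_insert, mem_singleton]
    constructor
    · rintro (h | h | h | h | ⟨h, h'⟩)
      · exact Or.inl h
      · exact Or.inr (Or.inl h)
      · exact Or.inr (Or.inr (Or.inl h))
      · exact Or.inr (Or.inr (Or.inr h))
      · exact absurd h' h5
    · rintro (h | h | h | h)
      · exact Or.inl h
      · exact Or.inr (Or.inl h)
      · exact Or.inr (Or.inr (Or.inl h))
      · exact Or.inr (Or.inr (Or.inr (Or.inl h)))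

omit hp' in
/-- The sum of a function over a four-point class. -/
theorem sum_four' {p x : ℕ} (hp0 : 0 < p) (f : ℕ → ℤ) :
    ∑ s ∈ ({x, x + p, x + 2 * p, x + 3 * p} : Finset ℕ), f s = f x + f (x + p) + f (x + 2 * p) + f (x + 3 * p) := by
  rw [sum_insert (by simp; omega), sum_insert (by simp; omega), sum_pair (by omega)]
  ring

include hp hp' in
/-- Four-point classes: the exponent sum is a lower bound for the class exponent. -/
theorem classExpC_ge_four {x : ℕ} (hx : x < p) (h5 : ¬ x + 4 * p ≤ 41 * n) :
    netExp (bRec n) x + netExp (bRec n) (x + p) + netExp (bRec n) (x + 2 * p) + netExp (bRec n) (x + 3 * p) ≤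
      classExp (bRec n) p x := by
  refine le_trans (le_of_eq ?_) (classExp_ge_sum _ _ _)
  rw [classSet_bRecC hp hp' hx, if_neg h5, sum_four' (by omega)]

include hp hp' in
/-- Five-point classes: the exponent sum is a lower bound for the class exponent. -/
theorem classExpC_ge_five {x : ℕ} (hx : x < p) (h5 : x + 4 * p ≤ 41 * n) :
    netExp (bRec n) x + netExp (bRec n) (x + p) + netExp (bRec n) (x + 2 * p) + netExp (bRec n) (x + 3 * p) +
      netExp (bRec n) (x + 4 * p) ≤ classExp (bRec n) p x := by
  refine le_trans (le_of_eq ?_) (classExp_ge_sum _ _ _)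
  rw [classSet_bRecC hp hp' hx, if_pos h5, sum_five' (by omega)]

include hp hp' in
/-- Four-point SELF-CONJUGATE classes (`2x + 3p = 41n`, odd `p`): the class exponent is the exponent sum plus the centre term `1`. -/
theorem classExpC_four_centre {x : ℕ} (hx : x < p) (hodd : ¬ 2 ∣ p) (hc : 2 * x + 3 * p = 41 * n) :
    classExp (bRec n) p x = netExp (bRec n) x + netExp (bRec n) (x + p) + netExp (bRec n) (x + 2 * p) +
      netExp (bRec n) (x + 3 * p) + 1 := by
  have hcen : ¬ (2 : ℤ) ∣ bRec n 0 ∧ CentreIn (bRec n) p x := by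
    rw [CentreIn, bRec_zero]
    refine ⟨fun h2 => hodd ?_, ⟨-3, by omega⟩⟩
    have h2' : (2 : ℤ) ∣ (p : ℤ) := by
      have e : (41 * (n : ℤ)) = 2 * ((x : ℤ) + p) + p := by omega
      rw [e] at h2
      exact (dvd_add_right (dvd_mul_right 2 _)).1 h2
    exact Int.natCast_dvd_natCast.1 h2'
  unfold classExp
  rw [if_pos hcen, classSet_bRecC hp hp' hx, if_neg (by omega), sum_four' (by omega)]

include hp hp' in
/-- **Centre-freeness**: a class `x < p` with `2x + 3p ≠ 41n` and `2x + 4p ≠ 41n` does not contain the centre residue. -/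
theorem not_centreInC {x : ℕ} (hx : x < p) (h3 : 2 * x + 3 * p ≠ 41 * n) (h4 : 2 * x + 4 * p ≠ 41 * n) :
    ¬ CentreIn (bRec n) p x := by
  rintro ⟨k, hk⟩
  rw [bRec_zero] at hk
  have hk1 : -5 < k := by
    by_contra hle
    push Not at hle
    have : (p : ℤ) * k ≤ (p : ℤ) * (-5) := mul_le_mul_of_nonneg_left hle (by omega)
    omega
  have hk2 : k < -2 := by
    by_contra hge
    push Not at hge
    have : (p : ℤ) * (-2) ≤ (p : ℤ) * k := mul_le_mul_of_nonneg_left hge (by omega)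
    omega
  interval_cases k <;> omega

end Classes

/-! ### §2 The minimal multipole classes -/

/-- Type `(1,−4,−6,1)`: `15n ≤ x+p`, `x+2p ≤ 24n`, no fifth point. -/
def CMinT1 (n p : ℕ) : Finset ℕ := (range p).filter fun x => 15 * n ≤ x + p ∧ x + 2 * p ≤ 24 * n ∧ 41 * n < x + 4 * p

/-- Type `(1,−5,−5,1)`: `16n ≤ x+p`, `x+2p ≤ 25n`, not self-conjugate (`2x + 3p ≠ 41n`). -/
def CMinS (n p : ℕ) : Finset ℕ := (range p).filter fun x => 16 * n ≤ x + p ∧ x + 2 * p ≤ 25 * n ∧ 2 * x + 3 * p ≠ 41 * n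

/-- Type `(1,−6,−4,1)`: `17n ≤ x+p`, `x+2p ≤ 26n` — the conjugates `41n − (x'+3p)` of the classes `x' ∈ CMinT1`. -/
def CMinT2 (n p : ℕ) : Finset ℕ := (range p).filter fun x => 17 * n ≤ x + p ∧ x + 2 * p ≤ 26 * n

/-- All minimal multipole classes of cell C. -/
def CMinAll (n p : ℕ) : Finset ℕ := CMinT1 n p ∪ CMinS n p ∪ CMinT2 n p

/-- Membership in `CMinT1`. -/
theorem mem_cminT1 {n p x : ℕ} : x ∈ CMinT1 n p ↔ x < p ∧ 15 * n ≤ x + p ∧ x + 2 * p ≤ 24 * n ∧ 41 * n < x + 4 * p := by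
  simp [CMinT1]
/-- Membership in `CMinS`. -/
theorem mem_cminS {n p x : ℕ} : x ∈ CMinS n p ↔ x < p ∧ 16 * n ≤ x + p ∧ x + 2 * p ≤ 25 * n ∧ 2 * x + 3 * p ≠ 41 * n := by
  simp [CMinS]
/-- Membership in `CMinT2`. -/
theorem mem_cminT2 {n p x : ℕ} : x ∈ CMinT2 n p ↔ x < p ∧ 17 * n ≤ x + p ∧ x + 2 * p ≤ 26 * n := by
  simp [CMinT2]

/-- `CMinAll ⊆ range p`. -/
theorem cminAll_subset (n p : ℕ) : CMinAll n p ⊆ range p := by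
  intro x hx
  simp only [CMinAll, mem_union, mem_cminT1, mem_cminS, mem_cminT2] at hx
  rw [mem_range]
  rcases hx with (h | h) | h
  · exact h.1
  · exact h.1
  · exact h.1

/-- `CMinT1` and `CMinS` are disjoint. -/
theorem disjoint_cminT1_cminS (n p : ℕ) : Disjoint (CMinT1 n p) (CMinS n p) := by
  rw [Finset.disjoint_left]
  intro x h1 h2
  rw [mem_cminT1] at h1; rw [mem_cminS] at h2
  omega

/-- `CMinT1 ∪ CMinS` and `CMinT2` are disjoint. -/
theorem disjoint_cminT1S_cminT2 (n p : ℕ) : Disjoint (CMinT1 n p ∪ CMinS n p) (CMinT2 n p) := by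
  rw [Finset.disjoint_left]
  intro x h12 h3
  rw [mem_union, mem_cminT1, mem_cminS] at h12; rw [mem_cminT2] at h3
  omega

section MinExps

variable {n p : ℕ} (hp : 17 * n < 2 * p) (hp' : 2 * p < 18 * n)

include hp hp' in
/-- Net exponents of a class of `CMinT1`: `(1,−4,−6,1)`, also for `b(n) + e₇`; four points; centre-free. -/
theorem netExp_cminT1 {x : ℕ} (hx : x ∈ CMinT1 n p) :
    (netExp (bRec n) x = 1 ∧ netExp (bRec n) (x + p) = -4 ∧ netExp (bRec n) (x + 2 * p) = -6 ∧
      netExp (bRec n) (x + 3 * p) = 1) ∧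
    (netExp (shift (bRec n) 7) x = 1 ∧ netExp (shift (bRec n) 7) (x + p) = -4 ∧
      netExp (shift (bRec n) 7) (x + 2 * p) = -6 ∧ netExp (shift (bRec n) 7) (x + 3 * p) = 1) ∧
    x < p ∧ x + 3 * p ≤ 41 * n ∧ 41 * n < x + 3 * p + p ∧ 2 * x + 3 * p ≠ 41 * n ∧ 2 * x + 4 * p ≠ 41 * n := by
  rw [mem_cminT1] at hx
  obtain ⟨hxp, h15, h24, h41⟩ := hx
  have e0 : netExp (bRec n) x = 1 := by
    rw [netExp_bRec_of_ne n x (by omega), dep7_low (by omega)]; norm_num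
  have e1 : netExp (bRec n) (x + p) = -4 := by
    rw [netExp_bRec_of_ne n (x + p) (by omega), dep7_lower (by norm_num : 5 ≤ 7) (by omega) (by omega)]; norm_num
  have e2 : netExp (bRec n) (x + 2 * p) = -6 := by
    rw [netExp_bRec_of_ne n (x + 2 * p) (by omega), dep7_well (by omega) (by omega)]; norm_num
  have e3 : netExp (bRec n) (x + 3 * p) = 1 := by
    rw [netExp_bRec_of_ne n (x + 3 * p) (by omega), dep7_high (by omega)]; norm_num
  refine ⟨⟨e0, e1, e2, e3⟩, ⟨?_, ?_, ?_, ?_⟩, hxp, by omega, by omega, by omega, by omega⟩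
  · rw [netExp_shift7 n x (by omega) (by omega), e0]
  · rw [netExp_shift7 n (x + p) (by omega) (by omega), e1]
  · rw [netExp_shift7 n (x + 2 * p) (by omega) (by omega), e2]
  · rw [netExp_shift7 n (x + 3 * p) (by omega) (by omega), e3]

include hp hp' in
/-- Net exponents of a class of `CMinS`: `(1,−5,−5,1)`, also for `b(n) + e₇`; four points; centre-free. -/
theorem netExp_cminS {x : ℕ} (hx : x ∈ CMinS n p) :
    (netExp (bRec n) x = 1 ∧ netExp (bRec n) (x + p) = -5 ∧ netExp (bRec n) (x + 2 * p) = -5 ∧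
      netExp (bRec n) (x + 3 * p) = 1) ∧
    (netExp (shift (bRec n) 7) x = 1 ∧ netExp (shift (bRec n) 7) (x + p) = -5 ∧
      netExp (shift (bRec n) 7) (x + 2 * p) = -5 ∧ netExp (shift (bRec n) 7) (x + 3 * p) = 1) ∧
    x < p ∧ x + 3 * p ≤ 41 * n ∧ 41 * n < x + 3 * p + p ∧ 2 * x + 3 * p ≠ 41 * n ∧ 2 * x + 4 * p ≠ 41 * n := by
  rw [mem_cminS] at hx
  obtain ⟨hxp, h16, h25, hself⟩ := hx
  have e0 : netExp (bRec n) x = 1 := by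
    rw [netExp_bRec_of_ne n x (by omega), dep7_low (by omega)]; norm_num
  have e1 : netExp (bRec n) (x + p) = -5 := by
    rw [netExp_bRec_of_ne n (x + p) (by omega), dep7_lower (by norm_num : 6 ≤ 7) (by omega) (by omega)]; norm_num
  have e2 : netExp (bRec n) (x + 2 * p) = -5 := by
    rw [netExp_bRec_of_ne n (x + 2 * p) (by omega), dep7_upper (by norm_num : 6 ≤ 7) (by omega) (by omega)]; norm_num
  have e3 : netExp (bRec n) (x + 3 * p) = 1 := by
    rw [netExp_bRec_of_ne n (x + 3 * p) (by omega), dep7_high (by omega)]; norm_num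
  refine ⟨⟨e0, e1, e2, e3⟩, ⟨?_, ?_, ?_, ?_⟩, hxp, by omega, by omega, hself, by omega⟩
  · rw [netExp_shift7 n x (by omega) (by omega), e0]
  · rw [netExp_shift7 n (x + p) (by omega) (by omega), e1]
  · rw [netExp_shift7 n (x + 2 * p) (by omega) (by omega), e2]
  · rw [netExp_shift7 n (x + 3 * p) (by omega) (by omega), e3]

include hp hp' in
/-- Net exponents of a class of `CMinT2`: `(1,−6,−4,1)`, also for `b(n) + e₇`; four points; centre-free. -/
theorem netExp_cminT2 {x : ℕ} (hx : x ∈ CMinT2 n p) :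
    (netExp (bRec n) x = 1 ∧ netExp (bRec n) (x + p) = -6 ∧ netExp (bRec n) (x + 2 * p) = -4 ∧
      netExp (bRec n) (x + 3 * p) = 1) ∧
    (netExp (shift (bRec n) 7) x = 1 ∧ netExp (shift (bRec n) 7) (x + p) = -6 ∧
      netExp (shift (bRec n) 7) (x + 2 * p) = -4 ∧ netExp (shift (bRec n) 7) (x + 3 * p) = 1) ∧
    x < p ∧ x + 3 * p ≤ 41 * n ∧ 41 * n < x + 3 * p + p ∧ 2 * x + 3 * p ≠ 41 * n ∧ 2 * x + 4 * p ≠ 41 * n := by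
  rw [mem_cminT2] at hx
  obtain ⟨hxp, h17, h26⟩ := hx
  have e0 : netExp (bRec n) x = 1 := by
    rw [netExp_bRec_of_ne n x (by omega), dep7_low (by omega)]; norm_num
  have e1 : netExp (bRec n) (x + p) = -6 := by
    rw [netExp_bRec_of_ne n (x + p) (by omega), dep7_well (by omega) (by omega)]; norm_num
  have e2 : netExp (bRec n) (x + 2 * p) = -4 := by
    rw [netExp_bRec_of_ne n (x + 2 * p) (by omega), dep7_upper (by norm_num : 5 ≤ 7) (by omega) (by omega)]; norm_num
  have e3 : netExp (bRec n) (x + 3 * p) = 1 := by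
    rw [netExp_bRec_of_ne n (x + 3 * p) (by omega), dep7_high (by omega)]; norm_num
  refine ⟨⟨e0, e1, e2, e3⟩, ⟨?_, ?_, ?_, ?_⟩, hxp, by omega, by omega, by omega, by omega⟩
  · rw [netExp_shift7 n x (by omega) (by omega), e0]
  · rw [netExp_shift7 n (x + p) (by omega) (by omega), e1]
  · rw [netExp_shift7 n (x + 2 * p) (by omega) (by omega), e2]
  · rw [netExp_shift7 n (x + 3 * p) (by omega) (by omega), e3]

end MinExps

/-- The conjugation `x ↦ 41n − (x + 3p)` maps `CMinT1` onto `CMinT2` … -/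
theorem conj_mem_cminT2 {n p x : ℕ} (hx : x ∈ CMinT1 n p) : 41 * n - (x + 3 * p) ∈ CMinT2 n p := by
  rw [mem_cminT1] at hx; rw [mem_cminT2]; omega
/-- … and `CMinT2` back onto `CMinT1` … -/
theorem conj_mem_cminT1 {n p x : ℕ} (hp' : 2 * p < 18 * n) (hx : x ∈ CMinT2 n p) : 41 * n - (x + 3 * p) ∈ CMinT1 n p := by
  rw [mem_cminT2] at hx; rw [mem_cminT1]; omega
/-- … and `CMinS` onto itself. -/
theorem conj_mem_cminS {n p x : ℕ} (hp : 17 * n < 2 * p) (hx : x ∈ CMinS n p) : 41 * n - (x + 3 * p) ∈ CMinS n p := by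
  rw [mem_cminS] at hx ⊢; omega

/-! ### §3 Every other class has `E_x ≥ −7` -/

section NotMin

variable {n p x : ℕ} (hp : 17 * n < 2 * p) (hp' : 2 * p < 18 * n) (hx : x < p)

include hp hp' hx in
/-- Regions `x + p < 15n`: `E_x ≥ −7` (five points unless `14n ≤ x+p`, even centre at `x+2p` allowed). -/
theorem classExpC_low (h15 : x + p < 15 * n) : -7 ≤ classExp (bRec n) p x := by
  have e0 : netExp (bRec n) x = 1 := by
    rw [netExp_bRec_of_ne n x (by omega), dep7_low (by omega)]; norm_num
  have a0 : x + p < 11 * n → netExp (bRec n) (x + p) = 1 := fun h => by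
    rw [netExp_bRec_of_ne n (x + p) (by omega), dep7_low (by omega)]; norm_num
  have a1 : 11 * n ≤ x + p → x + p < 12 * n → netExp (bRec n) (x + p) = 0 := fun h h' => by
    rw [netExp_bRec_of_ne n (x + p) (by omega), dep7_lower (by norm_num : 1 ≤ 7) (by omega) (by omega)]; norm_num
  have a2 : 12 * n ≤ x + p → x + p < 13 * n → netExp (bRec n) (x + p) = -1 := fun h h' => by
    rw [netExp_bRec_of_ne n (x + p) (by omega), dep7_lower (by norm_num : 2 ≤ 7) (by omega) (by omega)]; norm_num
  have a3 : 13 * n ≤ x + p → x + p < 14 * n → netExp (bRec n) (x + p) = -2 := fun h h' => by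
    rw [netExp_bRec_of_ne n (x + p) (by omega), dep7_lower (by norm_num : 3 ≤ 7) (by omega) (by omega)]; norm_num
  have a4 : 14 * n ≤ x + p → netExp (bRec n) (x + p) = -3 := fun h => by
    rw [netExp_bRec_of_ne n (x + p) (by omega), dep7_lower (by norm_num : 4 ≤ 7) (by omega) (by omega)]; norm_num
  have b1 : 2 * (x + 2 * p) ≠ 41 * n → netExp (bRec n) (x + 2 * p) = -6 := fun h => by
    rw [netExp_bRec_of_ne n (x + 2 * p) (by omega), dep7_well (by omega) (by omega)]; norm_num
  have b2 : 2 * (x + 2 * p) = 41 * n → netExp (bRec n) (x + 2 * p) = -5 := fun h => netExp_centre h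
  have c1 : x + 3 * p ≤ 26 * n → netExp (bRec n) (x + 3 * p) = -4 := fun h => by
    rw [netExp_bRec_of_ne n (x + 3 * p) (by omega), dep7_upper (by norm_num : 5 ≤ 7) (by omega) (by omega)]; norm_num
  have c2 : 26 * n < x + 3 * p → x + 3 * p ≤ 27 * n → netExp (bRec n) (x + 3 * p) = -3 := fun h h' => by
    rw [netExp_bRec_of_ne n (x + 3 * p) (by omega), dep7_upper (by norm_num : 4 ≤ 7) (by omega) (by omega)]; norm_num
  have c3 : 27 * n < x + 3 * p → x + 3 * p ≤ 28 * n → netExp (bRec n) (x + 3 * p) = -2 := fun h h' => by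
    rw [netExp_bRec_of_ne n (x + 3 * p) (by omega), dep7_upper (by norm_num : 3 ≤ 7) (by omega) (by omega)]; norm_num
  have c4 : 28 * n < x + 3 * p → x + 3 * p ≤ 29 * n → netExp (bRec n) (x + 3 * p) = -1 := fun h h' => by
    rw [netExp_bRec_of_ne n (x + 3 * p) (by omega), dep7_upper (by norm_num : 2 ≤ 7) (by omega) (by omega)]; norm_num
  have c5 : 29 * n < x + 3 * p → x + 3 * p ≤ 30 * n → netExp (bRec n) (x + 3 * p) = 0 := fun h h' => by
    rw [netExp_bRec_of_ne n (x + 3 * p) (by omega), dep7_upper (by norm_num : 1 ≤ 7) (by omega) (by omega)]; norm_num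
  have c6 : 30 * n < x + 3 * p → netExp (bRec n) (x + 3 * p) = 1 := fun h => by
    rw [netExp_bRec_of_ne n (x + 3 * p) (by omega), dep7_high (by omega)]; norm_num
  have d1 : netExp (bRec n) (x + 4 * p) = 1 := by
    rw [netExp_bRec_of_ne n (x + 4 * p) (by omega), dep7_high (by omega)]; norm_num
  by_cases h5 : x + 4 * p ≤ 41 * n
  · have hE := classExpC_ge_five hp hp' hx h5
    omega
  · have hE := classExpC_ge_four hp hp' hx h5
    omega

include hp hp' hx in
/-- Region `15n ≤ x + p < 16n` outside `CMinT1`: `(1, −4, −6|−5, 1 [,1])` with `e₂ = −5` or a fifth point. -/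
theorem classExpC_R5 (h15 : 15 * n ≤ x + p) (h16 : x + p < 16 * n) (hT1 : 24 * n < x + 2 * p ∨ x + 4 * p ≤ 41 * n) :
    -7 ≤ classExp (bRec n) p x := by
  have e0 : netExp (bRec n) x = 1 := by
    rw [netExp_bRec_of_ne n x (by omega), dep7_low (by omega)]; norm_num
  have e1 : netExp (bRec n) (x + p) = -4 := by
    rw [netExp_bRec_of_ne n (x + p) (by omega), dep7_lower (by norm_num : 5 ≤ 7) (by omega) (by omega)]; norm_num
  have b1 : x + 2 * p ≤ 24 * n → netExp (bRec n) (x + 2 * p) = -6 := fun h => by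
    rw [netExp_bRec_of_ne n (x + 2 * p) (by omega), dep7_well (by omega) (by omega)]; norm_num
  have b2 : 24 * n < x + 2 * p → netExp (bRec n) (x + 2 * p) = -5 := fun h => by
    rw [netExp_bRec_of_ne n (x + 2 * p) (by omega), dep7_upper (by norm_num : 6 ≤ 7) (by omega) (by omega)]; norm_num
  have e3 : netExp (bRec n) (x + 3 * p) = 1 := by
    rw [netExp_bRec_of_ne n (x + 3 * p) (by omega), dep7_high (by omega)]; norm_num
  by_cases h5 : x + 4 * p ≤ 41 * n
  · have e4 : netExp (bRec n) (x + 4 * p) = 1 := by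
      rw [netExp_bRec_of_ne n (x + 4 * p) (by omega), dep7_high (by omega)]; norm_num
    have hE := classExpC_ge_five hp hp' hx h5
    omega
  · have hE := classExpC_ge_four hp hp' hx h5
    omega

include hp hp' hx in
/-- Region `16n ≤ x + p < 17n` outside `CMinS`: four points `(1, −5, −5|−4, 1)` with `e₂ = −4`, or the self-conjugate class
`2x + 3p = 41n` (odd centre, `+1`). -/
theorem classExpC_R6 (hodd : ¬ 2 ∣ p) (h16 : 16 * n ≤ x + p) (h17 : x + p < 17 * n)
    (hS : 25 * n < x + 2 * p ∨ 2 * x + 3 * p = 41 * n) : -7 ≤ classExp (bRec n) p x := by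
  have e0 : netExp (bRec n) x = 1 := by
    rw [netExp_bRec_of_ne n x (by omega), dep7_low (by omega)]; norm_num
  have e1 : netExp (bRec n) (x + p) = -5 := by
    rw [netExp_bRec_of_ne n (x + p) (by omega), dep7_lower (by norm_num : 6 ≤ 7) (by omega) (by omega)]; norm_num
  have b1 : x + 2 * p ≤ 25 * n → netExp (bRec n) (x + 2 * p) = -5 := fun h => by
    rw [netExp_bRec_of_ne n (x + 2 * p) (by omega), dep7_upper (by norm_num : 6 ≤ 7) (by omega) (by omega)]; norm_num
  have b2 : 25 * n < x + 2 * p → netExp (bRec n) (x + 2 * p) = -4 := fun h => by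
    rw [netExp_bRec_of_ne n (x + 2 * p) (by omega), dep7_upper (by norm_num : 5 ≤ 7) (by omega) (by omega)]; norm_num
  have e3 : netExp (bRec n) (x + 3 * p) = 1 := by
    rw [netExp_bRec_of_ne n (x + 3 * p) (by omega), dep7_high (by omega)]; norm_num
  have hE := classExpC_ge_four hp hp' hx (by omega)
  have hEc : 2 * x + 3 * p = 41 * n → classExp (bRec n) p x = netExp (bRec n) x + netExp (bRec n) (x + p) +
      netExp (bRec n) (x + 2 * p) + netExp (bRec n) (x + 3 * p) + 1 := fun h => classExpC_four_centre hp hp' hx hodd h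
  omega

include hp hp' hx in
/-- Region `17n ≤ x + p` outside `CMinT2`: four points `(1, −6, −3, 1)`. -/
theorem classExpC_R7 (h17 : 17 * n ≤ x + p) (hT2 : 26 * n < x + 2 * p) : -7 ≤ classExp (bRec n) p x := by
  have e0 : netExp (bRec n) x = 1 := by
    rw [netExp_bRec_of_ne n x (by omega), dep7_low (by omega)]; norm_num
  have e1 : netExp (bRec n) (x + p) = -6 := by
    rw [netExp_bRec_of_ne n (x + p) (by omega), dep7_well (by omega) (by omega)]; norm_num
  have e2 : netExp (bRec n) (x + 2 * p) = -3 := by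
    rw [netExp_bRec_of_ne n (x + 2 * p) (by omega), dep7_upper (by norm_num : 4 ≤ 7) (by omega) (by omega)]; norm_num
  have e3 : netExp (bRec n) (x + 3 * p) = 1 := by
    rw [netExp_bRec_of_ne n (x + 3 * p) (by omega), dep7_high (by omega)]; norm_num
  have hE := classExpC_ge_four hp hp' hx (by omega)
  omega

include hp hp' hx in
/-- **THE NON-MINIMAL CLASSES**: for `x < p` outside `CMinT1 ∪ CMinS ∪ CMinT2`, `E_x(b(n), p) ≥ −7`. -/
theorem classExpC_ge_of_notMin (hodd : ¬ 2 ∣ p) (h1 : x ∉ CMinT1 n p) (h2 : x ∉ CMinS n p) (h3 : x ∉ CMinT2 n p) :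
    -7 ≤ classExp (bRec n) p x := by
  rw [mem_cminT1] at h1; rw [mem_cminS] at h2; rw [mem_cminT2] at h3
  by_cases h15 : x + p < 15 * n
  · exact classExpC_low hp hp' hx h15
  push Not at h15
  by_cases h16 : x + p < 16 * n
  · refine classExpC_R5 hp hp' hx h15 h16 ?_
    by_contra hc; push Not at hc; exact h1 ⟨hx, h15, hc.1, hc.2⟩
  push Not at h16
  by_cases h17 : x + p < 17 * n
  · refine classExpC_R6 hp hp' hx hodd h16 h17 ?_
    by_contra hc; push Not at hc; exact h2 ⟨hx, h16, hc.1, hc.2⟩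
  push Not at h17
  refine classExpC_R7 hp hp' hx h17 ?_
  by_contra hc; push Not at hc; exact h3 ⟨hx, h17, hc⟩

end NotMin

end Summit.KontsevichZagierPeriods.Zeta5Search.CellC
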